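import Mathlib
import HarnessLib
import Summits.HubbardSuperconductivity.HubbardSuperconductivity.Theorems.KLProgrammeKLRegimeTwoVolumeSrcUVLevelOne
import Summits.HubbardSuperconductivity.HubbardSuperconductivity.Theorems.KLProgrammeKLRegimeOverlapWtColFlowAll
import Summits.HubbardSuperconductivity.HubbardSuperconductivity.Theorems.KLProgrammeKLRegimeOverlapWtJumpFlowAll
import Summits.HubbardSuperconductivity.HubbardSuperconductivity.Theorems.KLProgrammeKLRegimeAlphaWtFlowDeep
import Summits.HubbardSuperconductivity.HubbardSuperconductivity.Theorems.KLProgrammeKLRegimeVolumeLimitV11TowerDataOfSuppliers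
import Summits.HubbardSuperconductivity.HubbardSuperconductivity.Theorems.KLProgrammeKLRegimeTwoVolumeSrcTowerProducer

/-!
# Route `KLProgramme` — crux K3, VL child `KLRegimeVolumeLimitV17F3` (stmt-HubbardSuperconductivity-23356), skeleton «cauchy» v12W-7 (e331b8c44158451f):
# THE UV ATOM `stub_vl_srcUVW` FROM `stub_vl_HE1free` ALONE (seat hubbard-kl-k3c4-p1 g20, VL lead; `--supports` 23356)

The registered UV atom (windowed currency, history-bound) asks token #24-W at the levels `0, 1` of the top flow frame under the top history, the (K5′) clauses at `c″`
and `Z^{K_top}_{Λ_{k+1}} ≠ 0`.  Both levels are now THEOREMS of the p3 lineage: level `0` for every `FrameOK` frame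
(`…EngineScaleOneSrcProfileW.exists_sourceProfilesAtLevF_srcWindow_zero`, p684624) and level `1` by route (B) — one block step `(J₁,J₂,J′) = (1,2,1)` of the
family-generic source tower (`…TwoVolumeSrcUVLevelOne.exists_sourceProfilesAtLevF_srcWindow_one`, p686409) — whose inputs at the instance are: `FrameOK K_top` (from
the history, `frameOK_klFlowFrameU_of_histP_le`), `Z^{K_top}_{Λ₁} ≠ 0`, E1's ALIVE read-out of `𝒱_1[K_top]` at level `0` with its law (= the `j = 0` clauses of
`stub_vl_HE1free`), and E1's rate-`1` overlap rows/columns of `E(F_1[K_top])·S(F̃_0[K_top])` (`overlapWt_jump_sums_klEng_flow_all` / `overlapWt_colSum_klEng_flow_all`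
at `(k, J′) = (0, 1)`, history- and (K5′)-bound — exactly the atom's hypotheses).  Hence:
* **`srcUVW_of_HE1free (HE1free) : <the registered text of stub_vl_srcUVW>`** — the UV atom is REDUNDANT given `stub_vl_HE1free`; the VL child's open content is
  {`stub_vl_HE1free`, `stub_vl_flowPieceOscTE`} (both engine-lineage).
Quantifier threading over landed theorems; nothing asserts HE1free, the atom, VL, K3 or superconductivity. [cite: BenfattoGiulianiMastropietro2006, §2.7-§2.9, §3]
-/

noncomputable section

namespace Summit.HubbardSuperconductivity.HubbardSuperconductivity.Theorems.TwoVolumeSource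

set_option linter.dupNamespace false -- summit = problem name (single-conjunct summit), D-0017

open Finset Filter Topology Literature.MathematicalPhysics.QuantumLattice GrassmannAlgebra Literature.Probability.LatticeModels
open Summit.HubbardSuperconductivity.HubbardSuperconductivity.Theorems.KLRegimeSplit
open Summit.HubbardSuperconductivity.HubbardSuperconductivity.Theorems.KLProgrammeLegKernels
open Summit.HubbardSuperconductivity.HubbardSuperconductivity.Theorems.EngineV8
open Summit.HubbardSuperconductivity.HubbardSuperconductivity.Theorems.TwoVolumeDefect
open Summit.HubbardSuperconductivity.HubbardSuperconductivity.Theorems.TorusFourierL2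
open Summit.HubbardSuperconductivity.HubbardSuperconductivity.Theorems.DispersionFlow

set_option maxHeartbeats 1600000 in -- long binder blocks threaded through five suppliers
/-- **The registered UV atom `stub_vl_srcUVW` (v12W-7) from `stub_vl_HE1free`'s text**: level `0` = p3's p684624, level `1` = p3's p686409 fed with `FrameOK` from the
history, `Z ≠ 0` and the alive level-`0` read-out from `HE1free`, and E1's rate-`1` overlap rows/columns at `(k, J′) = (0, 1)` from the history and the (K5′) clauses.
[folklore: quantifier threading; cite: BenfattoGiulianiMastropietro2006, §2.7-§2.9, §3] -/
theorem srcUVW_of_HE1free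
    (HE1 : ∀ (P : SplitConsts) (R : RenConsts), P.WF → R.WF2 →
      ∃ Q₁ : EngConsts, 0 ≤ Q₁.CE ∧ ∃ C₀ : ℝ, 0 ≤ C₀ ∧
        ∃ c₇ : ℝ, 0 < c₇ ∧ ∀ c : ℝ, 0 < c → c ≤ c₇ → ∃ U₇ : ℝ, 0 < U₇ ∧
          ∀ μ ∈ klWindowC, ∀ U : ℝ, 0 < U → U ≤ U₇ → ∀ β : ℝ, klBetaMin ≤ β → β ≤ Real.exp (c / U ^ 2) →
            ∃ S₀ : ℕ → ℕ → ℝ, (∀ j m, 0 ≤ S₀ j m) ∧ (∀ j, j ≤ nScales β → ∀ m, 1 ≤ m → S₀ j (2 * m) ≤ C₀ * klWtBudget P Q₁ U (j + 1) (2 * m)) ∧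
            ∃ L₂ : ℕ, ∃ M₂ : ℕ → ℕ, ∀ (L M : ℕ) [NeZero L] [NeZero M], L₂ ≤ L → M₂ L ≤ M →
              (∀ k, k ≤ nScales β → hubbardEffPartitionFnCT L M β U μ 0 (klFlowFrameU L M β U μ (nScales β + 1)) (klScale klE0 (k + 1)) ≠ 0) ∧
              (∀ j, j ≤ nScales β → ∀ (m : ℕ) (q : Fin m) (w : SpaceTimeIdx L M × SectorLeg (sectorCount j)),
                klWtPinnedSumAt L M β μ (klFlowFrameU L M β U μ (nScales β + 1)) j j m (klEffectiveAction L M β U μ (klFlowFrameU L M β U μ (nScales β + 1)) klE0 (j + 1)) q w ≤ S₀ j m)) :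
    ∀ (G : GeoConsts) (P : SplitConsts) (Q : EngConsts) (R : RenConsts), P.WF → R.WF2 → ∀ c'' : ℝ, 0 < c'' →
      ∃ Q₀ : EngConsts, 0 ≤ Q₀.CE ∧ ∃ c₀ : ℝ, 0 < c₀ ∧ ∀ c : ℝ, 0 < c → c ≤ c₀ → ∃ U₀ : ℝ, 0 < U₀ ∧
        ∀ μ ∈ klWindowC, ∀ U : ℝ, 0 < U → U ≤ U₀ → ∀ β : ℝ, klBetaMin ≤ β → β ≤ Real.exp (c / U ^ 2) →
          ∃ A₀ : ℝ, 0 ≤ A₀ ∧ ∃ L₁ : ℕ, ∃ M₁ : ℕ → ℕ, ∀ (L M : ℕ) [NeZero L] [NeZero M], L₁ ≤ L → M₁ L ≤ M →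
            HistP klPredsV17F2 L M G P Q R β U μ 0 (nScales β + 1) →
            (∀ m : ℕ, 1 ≤ m → m < nScales β + 1 → FlowPieceOscAt L M c'' β U μ m) →
            (∀ k, k ≤ nScales β → hubbardEffPartitionFnCT L M β U μ 0 (klFlowFrameU L M β U μ (nScales β + 1)) (klScale klE0 (k + 1)) ≠ 0) →
            ∀ j : ℕ, j ≤ 1 → j + 1 ≤ nScales β + 1 →
              SourceProfilesAtLevF L M (klSrcBudget P Q₀ U (fun _ _ => A₀) (j + 1)) β U μ (klFlowFrameU L M β U μ (nScales β + 1)) (srcWindowFamily L M) j j (j + 1) := by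
  intro G P Q R hP hR2 c'' hc''
  have hKl : 0 ≤ P.Klam := le_trans zero_le_one hP.1
  have hGfr : ∀ i, 0 ≤ R.Gfr i := gfr_nonneg_of_wf2 hR2
  -- the suppliers' constants (all before `c`)
  obtain ⟨Q₁, hQ₁, C₀, hC₀, c₇, hc₇, hHE⟩ := HE1 P R hP hR2
  obtain ⟨CJr, -, hrowsAll⟩ := overlapWt_jump_sums_klEng_flow_all R c'' hc''.le
  obtain ⟨CJc, -, hcolsAll⟩ := overlapWt_colSum_klEng_flow_all R c'' hc''.le
  obtain ⟨CE₀, hCE₀, c₉₀, hc₉₀, h0⟩ := exists_sourceProfilesAtLevF_srcWindow_zero P R hP hR2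
  obtain ⟨Qo, hQo, c₉₁, hc₉₁, h1⟩ := exists_sourceProfilesAtLevF_srcWindow_one P R hP hR2 Q₁ hQ₁ C₀ hC₀ CJr CJc
  -- one package above both levels' packages
  set Q₀ : EngConsts := { Q with CE := max CE₀ Qo.CE } with hQ₀
  have hQ₀CE : Q₀.CE = max CE₀ Qo.CE := rfl
  have hQ₀0 : 0 ≤ Q₀.CE := by rw [hQ₀CE]; exact hCE₀.trans (le_max_left _ _)
  refine ⟨Q₀, hQ₀0, min (min c₇ (klEngC₃6 P R)) (min c₉₀ c₉₁), lt_min (lt_min hc₇ (klEngC₃6_pos P R)) (lt_min hc₉₀ hc₉₁), fun c hc hcc => ?_⟩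
  have hcc₇ : c ≤ c₇ := hcc.trans ((min_le_left _ _).trans (min_le_left _ _))
  have hc6 : c ≤ klEngC₃6 P R := hcc.trans ((min_le_left _ _).trans (min_le_right _ _))
  have hcc₀ : c ≤ c₉₀ := hcc.trans ((min_le_right _ _).trans (min_le_left _ _))
  have hcc₁ : c ≤ c₉₁ := hcc.trans ((min_le_right _ _).trans (min_le_right _ _))
  obtain ⟨U₇, hU₇, hHE'⟩ := hHE c hc hcc₇
  obtain ⟨U₈, hU₈, h0'⟩ := h0 c hc hcc₀
  obtain ⟨U₉, hU₉, h1'⟩ := h1 c hc hcc₁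
  set U₀ : ℝ := min (min U₇ (min U₈ U₉)) (min (min (klEngU₀3 P R c) (1 / (R.Gfr 3 + 1))) (1 / c'')) with hU₀
  have hU₀0 : 0 < U₀ := by
    refine lt_min (lt_min hU₇ (lt_min hU₈ hU₉)) (lt_min (lt_min (klEngU₀3_pos P R c) ?_) ?_)
    · have := hGfr 3; positivity
    · positivity
  refine ⟨U₀, hU₀0, fun μ hμ U hU hUU β hβmin hβc => ?_⟩
  have hUU₇ : U ≤ U₇ := hUU.trans ((min_le_left _ _).trans (min_le_left _ _))
  have hUU₈ : U ≤ U₈ := hUU.trans ((min_le_left _ _).trans ((min_le_right _ _).trans (min_le_left _ _)))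
  have hUU₉ : U ≤ U₉ := hUU.trans ((min_le_left _ _).trans ((min_le_right _ _).trans (min_le_right _ _)))
  have hU3 : U ≤ min (klEngU₀3 P R c) (1 / (R.Gfr 3 + 1)) := hUU.trans ((min_le_right _ _).trans (min_le_left _ _))
  have hUc'' : U ≤ 1 / c'' := hUU.trans ((min_le_right _ _).trans (min_le_right _ _))
  have hcU : c'' * U ≤ 1 := by rw [le_div_iff₀ hc''] at hUc''; linarith
  -- the three suppliers at `(μ, U, β)`
  obtain ⟨S₀, hS₀0, hS₀law, L₂, M₂, hHE''⟩ := hHE' μ hμ U hU hUU₇ β hβmin hβc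
  obtain ⟨A₀, hA₀, h0''⟩ := h0' μ hμ U hU hUU₈ β hβmin hβc
  obtain ⟨A₁, hA₁, h1''⟩ := h1' μ hμ U hU hUU₉ β hβmin hβc
  have hA₀0 : 0 ≤ A₀ := zero_le_one.trans hA₀
  refine ⟨max A₀ A₁, hA₀0.trans (le_max_left _ _), max (klEngL₃ β U) L₂, fun L => max (klEngM₃ β U L) (M₂ L), ?_⟩
  intro L M _ _ hL hM hhist hosc hZ j hj hjn
  have hL3 : klEngL₃ β U ≤ L := (le_max_left _ _).trans hL
  have hM3 : klEngM₃ β U L ≤ M := (le_max_left _ _).trans hM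
  have hL2 : L₂ ≤ L := (le_max_right _ _).trans hL
  have hM2 : M₂ L ≤ M := (le_max_right _ _).trans hM
  -- the top flow frame is admissible (from the history)
  have hfr : FrameOK R U (nScales β) μ (klFlowFrameU L M β U μ (nScales β + 1)) :=
    frameOK_klFlowFrameU_of_histP_le hR2 (by omega) le_rfl le_rfl hhist
  rcases Nat.le_one_iff_eq_zero_or_eq_one.1 hj with rfl | rfl
  · -- level 0
    exact (h0'' L M hL3 hM3 _ hfr Q₀ (by rw [hQ₀CE]; exact le_max_left _ _)).mono fun s m =>
      klSrcBudget_mono_A P Q₀ U hQ₀0 hKl (fun _ _ => le_max_left A₀ A₁) 1 s m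
  · -- level 1: E1's alive read-out at level 0, E1's rate-1 overlap rows/columns at `(k, J′) = (0, 1)`, then p3's block step
    obtain ⟨hZ', hread⟩ := hHE'' L M hL2 hM2
    have hreg : IsKLRegime U c (-((nScales β + 1 : ℕ) : ℤ)) := isKLRegime_of_le_nScales_succ hc.le hβmin hβc le_rfl
    have hrow := (hrowsAll G P Q c hR2 hc hc6 μ hμ U hU hU3 hcU β hβmin hβc L M hL3 hM3 (nScales β + 1) (by omega) le_rfl hreg hhist hosc
      0 1 (by omega) (by omega)).1
    have hcol := hcolsAll G P Q c hR2 hc hc6 μ hμ U hU hU3 hcU β hβmin hβc L M hL3 hM3 (nScales β + 1) (by omega) le_rfl hreg hhist hosc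
      0 1 (by omega) (by omega) 1 le_rfl
    have h := h1'' L M hL3 hM3 (klFlowFrameU L M β U μ (nScales β + 1)) hfr (hZ 0 (Nat.zero_le _)) (S₀ 0) (hS₀0 0)
      (fun d hd => hS₀law 0 (Nat.zero_le _) d hd) (hread 0 (Nat.zero_le _)) hrow (fun X' => by simpa using hcol X')
    refine h.mono fun s m => ?_
    exact (klSrcBudget_mono_CE P U (A := fun _ _ => A₁) (fun _ _ => hA₁) hQo (by rw [hQ₀CE]; exact le_max_right _ _) hKl 2 s m).trans
      (klSrcBudget_mono_A P Q₀ U hQ₀0 hKl (fun _ _ => le_max_right A₀ A₁) 2 s m)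

end Summit.HubbardSuperconductivity.HubbardSuperconductivity.Theorems.TwoVolumeSource

end
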